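import Summits.Parity.GeneralizedHardyLittlewood.Theorems.DicksonFibrationDimOneStubPrimeSieveAux3
import Summits.Parity.GeneralizedHardyLittlewood.Theorems.LeeYangFibresAbsoluteUpgradeSinglesDecayCases
import HarnessLib

/-!
# Route `DicksonFibration`, crux `DimOne` (stmt-Parity-0819), line `birth` (sieve-model reshape):
# helper file 4 for the stub `stub_primeSieve` — the generic case (Fundamental Lemma for the weighted
# sequence) and two numerics

Tools for the registered stub `stub_primeSieve : PrimeSieve` (file
`Theorems/DicksonFibrationDimOneStubPrimeSieve.lean`):

* `abs_sifted_sum_sub_le` — **the generic case**: off the local obstructions, the Fundamental Lemma for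
  the weighted value sequence of helper file 1 (density `g` of helper file 2, dimension
  `2(L + t)` by helper file 3) with the class sums of `Λ` (an instance of `PrimeClassSums`) bounding the
  remainders (`abs_sum_classSum_sub_le`, `density_mul_totient`):
  `|Σ_{m ∈ I : (ψ_k(m), P(z)) = 1 ∀ k ≠ i} Λ(ψ_i(m)) − X_i V(z)| ≤ C_FL X_i V(z) e^{−log D/log z}
    + max(C,1) x/(log x)^{t+1} + D² (log x/log 2 + 1) log x`;
* `theta_le`, `weight_pow_mul_bv_le` (registered sub-goal) — the numerics
  `(log x/log 2 + 1) log x ≤ 12 (log N)²` and `W^t · C' x/(log x)^{t+1} ≤ (ε/3) N` at `x = 2LN`.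

References: H. Halberstam, H.-E. Richert, *Sieve Methods* (1974), Thm. 2.5 and §5.7
[HalberstamRichert1974]; J. Friedlander, H. Iwaniec, *Opera de Cribro* (2010), Cor. 6.10
[FriedlanderIwaniecOpera2010].
-/

noncomputable section

open scoped BigOperators Classical
open Finset Polynomial Literature.NumberTheory.Sieve
open Summit.Parity.GeneralizedHardyLittlewood.Theorems.AbsoluteUpgrade

namespace Summit.Parity.GeneralizedHardyLittlewood.Cruxes.DimOne.BirthSieve

section Cases

open Filter

variable {t : ℕ}

/-- `(log x/log 2 + 1) log x ≤ 12 (log N)²` once `1 ≤ log x ≤ 2 log N`. [folklore] -/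
theorem theta_le {x lN : ℝ} (hx1 : 1 ≤ Real.log x) (hx2 : Real.log x ≤ 2 * lN) :
    (Real.log x / Real.log 2 + 1) * Real.log x ≤ 12 * lN ^ 2 := by
  have hlog2 : (1 : ℝ) / 2 < Real.log 2 := by
    have := Real.log_two_gt_d9; linarith
  have h0 : 0 ≤ Real.log x := by linarith
  have h1 : Real.log x / Real.log 2 ≤ 2 * Real.log x := by
    rw [div_le_iff₀ (by linarith)]; nlinarith
  calc (Real.log x / Real.log 2 + 1) * Real.log x ≤ (2 * Real.log x + Real.log x) * Real.log x :=
        mul_le_mul_of_nonneg_right (by linarith) h0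
    _ = 3 * Real.log x ^ 2 := by ring
    _ ≤ 3 * (2 * lN) ^ 2 := by gcongr
    _ = 12 * lN ^ 2 := by ring

/-- Numerics of the Bombieri–Vinogradov remainder: `W^t · C' x/(log x)^{t+1} ≤ (ε/3) N` for `x = 2LN`
once `W^t ≤ (e⁵ log N)^t`, `log x ≥ log N ≥ 6 L C' e^{5t}/ε`. [folklore] -/
theorem weight_pow_mul_bv_le : ∀ {t : ℕ} {W C' L N x ε : ℝ}, W ^ t ≤ Real.exp 5 ^ t * Real.log N ^ t → 0 ≤ C' → 0 ≤ L → 0 < N → 0 < ε → x = 2 * L * N → 0 < Real.log N → Real.log N ≤ Real.log x → 6 * L * C' * Real.exp 5 ^ t / ε ≤ Real.log N → W ^ t * (C' * x / Real.log x ^ (t + 1)) ≤ ε / 3 * N := by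
  intro t W C' L N x ε hWt hC' hL hN hε hx hlogN hlogx hClog
  have hlogx0 : 0 < Real.log x := lt_of_lt_of_le hlogN hlogx
  have hx0 : 0 ≤ x := by rw [hx]; positivity
  have h1 : W ^ t * (C' * x / Real.log x ^ (t + 1)) ≤
      Real.exp 5 ^ t * Real.log x ^ t * (C' * x / Real.log x ^ (t + 1)) := by
    refine mul_le_mul_of_nonneg_right (hWt.trans ?_) (by positivity)
    exact mul_le_mul_of_nonneg_left (pow_le_pow_left₀ hlogN.le hlogx t) (by positivity)
  have h2 : Real.exp 5 ^ t * Real.log x ^ t * (C' * x / Real.log x ^ (t + 1)) =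
      Real.exp 5 ^ t * C' * x / Real.log x := by
    rw [pow_succ]
    field_simp
  have h3 : Real.exp 5 ^ t * C' * x / Real.log x ≤ Real.exp 5 ^ t * C' * x / Real.log N :=
    div_le_div_of_nonneg_left (by positivity) hlogN hlogx
  have h4 : Real.exp 5 ^ t * C' * x / Real.log N ≤ ε / 3 * N := by
    rw [div_le_iff₀ hlogN, hx]
    rw [div_le_iff₀ hε] at hClog
    have e : Real.exp 5 ^ t * C' * (2 * L * N) = (6 * L * C' * Real.exp 5 ^ t) * N / 3 := by ring
    rw [e, div_le_iff₀ (by norm_num : (0 : ℝ) < 3)]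
    calc 6 * L * C' * Real.exp 5 ^ t * N ≤ Real.log N * ε * N := mul_le_mul_of_nonneg_right hClog hN.le
      _ = ε / 3 * N * Real.log N * 3 := by ring
  linarith

/-- **The generic case: the Fundamental Lemma for the weighted sequence.** Off the local obstructions,
with the Fundamental Lemma (`hFL`, dimension `2(L + t)`) and the class sums of `Λ` (`hC`, an instance of
`PrimeClassSums` with `B = L + t`, `A = t + 1`) as inputs: for the one-prime sifted sum over
`I = [m₁, m₂]` sieved by the primes `< z` at level `D ≥ z`,
`|Σ_{m ∈ I : (ψ_k(m), P(z)) = 1 ∀ k ≠ i} Λ(ψ_i(m)) − X_i V(z)| ≤ C_FL X_i V(z) e^{−log D/log z}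
  + max(C, 1) x/(log x)^{t+1} + D² (log x/log 2 + 1) log x`
with `X_i = (|a_i|/φ(|a_i|)) #I`, `V(z) = ∏_{p<z} (1 − g_p)` (dictionary `sifted_eq_of_eq`, remainders
`abs_sum_classSum_sub_le` and `density_mul_totient`). [cite: HalberstamRichert1974, Thm. 2.5] -/
theorem abs_sifted_sum_sub_le {L : ℕ} {CFL : ℝ}
    (hFL : ∀ A : SieveSequence, HasSieveDimension A.density ((2 * (L + t) : ℕ) : ℝ)
        (Real.exp (((2 * (L + t) : ℕ) : ℝ) * (9 / 2 + 6 / Real.log 2) +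
          ((2 * (L + t) : ℕ) : ℝ) ^ 2 / (1 / ((2 * (L + t) : ℕ) + 2 : ℝ)))) →
      ∀ x z D : ℝ, 2 ≤ z → z ≤ D → 0 ≤ A.size x →
        |A.sifted x (primesProdBelow z) - A.size x * A.densityProduct (primesProdBelow z)| ≤
          CFL * A.size x * A.densityProduct (primesProdBelow z) *
              Real.exp (-(Real.log D / Real.log z)) +
            ∑ d ∈ (primesProdBelow z).divisors.filter (fun d : ℕ => (d : ℝ) ≤ D),
              |A.remainder d x|)
    {C x₀ : ℝ}
    (hC : ∀ x : ℝ, x₀ ≤ x → ∀ F : Polynomial ℤ, (∀ p : ℕ, p.Prime → polyRootCountMod ![F] p ≤ L + t) →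
      ∀ (a b m₁ m₂ : ℤ), a ≠ 0 → IsCoprime a b → m₁ ≤ m₂ →
        (∀ m ∈ Finset.Icc m₁ m₂, 1 ≤ a * m + b) →
          (∀ m ∈ Finset.Icc m₁ m₂, ((a * m + b : ℤ) : ℝ) ≤ x) →
            ∀ D : ℕ, ((a.natAbs * D : ℕ) : ℝ) ≤ x ^ (1 / 4 : ℝ) →
              ∑ d ∈ (Finset.Icc 1 D).filter Squarefree,
                ∑ s ∈ (rootsMod F d).filter (fun s : ℕ => Int.gcd (a * s + b) d = 1),
                  |∑ m ∈ (Finset.Icc m₁ m₂).filter (fun m : ℤ => m ≡ (s : ℤ) [ZMOD d]),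
                      intVonMangoldt (a * m + b) -
                    (a.natAbs : ℝ) * (#(Finset.Icc m₁ m₂) : ℝ) / (Nat.totient (a.natAbs * d) : ℝ)|
                ≤ C * x / Real.log x ^ (t + 1))
    {Ψ : Fin (t + 1) → AffLinForm 1} (hΨ : IsNondegenerateSystem Ψ)
    (haL : ∀ k, ((Ψ k).coeff 0).natAbs ≤ L) (i : Fin (t + 1))
    (hobs : ∀ p : ℕ, p.Prime → polyRootCountMod ![sysPoly Ψ] p < p)
    {m₁ m₂ : ℤ} (hm : m₁ ≤ m₂) (hIpos : ∀ m ∈ Icc m₁ m₂, ∀ k, 1 ≤ (Ψ k).eval (fun _ => m))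
    {x : ℝ} (hx1 : 1 ≤ x) (hx₀ : x₀ ≤ x)
    (hxle : ∀ m ∈ Icc m₁ m₂, (((Ψ i).coeff 0 * m + (Ψ i).const : ℤ) : ℝ) ≤ x)
    {z D : ℝ} (hz : 2 ≤ z) (hzD : z ≤ D)
    (hDn : ((((Ψ i).coeff 0).natAbs * ⌊D⌋₊ : ℕ) : ℝ) ≤ x ^ (1 / 4 : ℝ)) {g : ArithmeticFunction ℝ}
    (hg : ∀ d : ℕ, d ≠ 0 → g d = ∏ p ∈ d.primeFactors,
      (#((rootsMod (sysPoly (Fin.removeNth i Ψ)) p).filter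
          (fun s : ℕ => Int.gcd ((Ψ i).coeff 0 * s + (Ψ i).const) p = 1)) : ℝ) /
        (if (p : ℤ) ∣ (Ψ i).coeff 0 then (p : ℝ) else (p : ℝ) - 1)) :
    |∑ m ∈ (Icc m₁ m₂).filter
          (fun m : ℤ => ∀ k, k ≠ i → Int.gcd ((Ψ k).eval (fun _ => m)) (primesProdBelow z) = 1),
        intVonMangoldt ((Ψ i).coeff 0 * m + (Ψ i).const) -
      ((((Ψ i).coeff 0).natAbs : ℝ) / (Nat.totient ((Ψ i).coeff 0).natAbs : ℝ) * #(Icc m₁ m₂)) *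
        ∏ p ∈ Nat.primesBelow ⌈z⌉₊, (1 - g p)| ≤
      CFL * ((((Ψ i).coeff 0).natAbs : ℝ) / (Nat.totient ((Ψ i).coeff 0).natAbs : ℝ) * #(Icc m₁ m₂)) *
          (∏ p ∈ Nat.primesBelow ⌈z⌉₊, (1 - g p)) * Real.exp (-(Real.log D / Real.log z)) +
        (max C 1 * x / Real.log x ^ (t + 1) + D ^ 2 * ((Real.log x / Real.log 2 + 1) * Real.log x)) := by
  set I := Icc m₁ m₂ with hIdef
  set a : ℤ := (Ψ i).coeff 0 with hadef
  set b : ℤ := (Ψ i).const with hbdef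
  set F := sysPoly (Fin.removeNth i Ψ) with hF
  set Θ : ℝ := (Real.log x / Real.log 2 + 1) * Real.log x with hΘ
  set α : ℕ := a.natAbs with hα
  set Xi : ℝ := (α : ℝ) / (Nat.totient α : ℝ) * #I with hXi
  set V := ∏ p ∈ Nat.primesBelow ⌈z⌉₊, (1 - g p) with hVdef
  have ha0 : a ≠ 0 := coeff_ne_zero_of_nondegenerate hΨ i
  have hev : ∀ m : ℤ, (Ψ i).eval (fun _ => m) = a * m + b := fun m => by rw [DimOne.eval_eq]
  have hab1 : ∀ m ∈ I, 1 ≤ a * m + b := fun m hm => by rw [← hev]; exact hIpos m hm i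
  have hab : IsCoprime a b := isCoprime_of_unobstructed Ψ i hobs
  have hdim := hasSieveDimension_density hΨ haL i hobs hg
  have hΨ' : IsNondegenerateSystem (Fin.removeNth i Ψ) :=
    ⟨fun k => hΨ.1 (i.succAbove k), fun k l hkl a' b' h =>
      hΨ.2 (i.succAbove k) (i.succAbove l) (fun e => hkl (Fin.succAbove_right_injective e)) a' b' h⟩
  have haL' : ∀ k, ((Fin.removeNth i Ψ k).coeff 0).natAbs ≤ L := fun k => haL (i.succAbove k)
  have hFB : ∀ p : ℕ, p.Prime → polyRootCountMod ![F] p ≤ L + t := fun p hp =>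
    rootCount_le_add hΨ' haL' hp
  have hα1 : 0 < α := Int.natAbs_pos.mpr ha0
  have hα0 : (0 : ℝ) < α := by exact_mod_cast hα1
  have hφα : (0 : ℝ) < Nat.totient α := by exact_mod_cast Nat.totient_pos.mpr hα1
  have hXi0 : 0 ≤ Xi := by positivity
  have hΘ0 : 0 ≤ Θ := by
    have hlog2 : 0 < Real.log 2 := Real.log_pos one_lt_two
    have : 0 ≤ Real.log x := Real.log_nonneg hx1
    positivity
  have hD0 : 0 ≤ D := by linarith
  -- the weighted sequence
  let A : SieveSequence :=
    { a := fun v => ∑ n ∈ I.filter (fun n : ℤ => F.eval n = (v : ℤ)), intVonMangoldt (a * n + b)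
      a_nonneg := fun _ => Finset.sum_nonneg fun _ _ => ArithmeticFunction.vonMangoldt_nonneg
      size := fun _ => Xi
      density := g
      density_mult := BoundedClassDensity.isMultiplicative_of_apply_eq_prod hg }
  have hAa : ∀ v : ℕ, A.a v = ∑ n ∈ I.filter (fun n : ℤ => F.eval n = (v : ℤ)), intVonMangoldt (a * n + b) :=
    fun _ => rfl
  have hAsize : ∀ y : ℝ, A.size y = Xi := fun _ => rfl
  have hAdens : A.density = g := rfl
  -- `F > 0` on `I`
  have hFpos : ∀ m ∈ I, 0 < F.eval m ∧ ((F.eval m : ℤ) : ℝ) ≤ ∑ m' ∈ I, ((F.eval m' : ℤ) : ℝ) := by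
    have hpos : ∀ m ∈ I, 0 < F.eval m := fun m hm => by
      rw [hF, sysPoly_removeNth_eval]
      exact Finset.prod_pos fun k _ => lt_of_lt_of_le zero_lt_one (hIpos m hm _)
    intro m hm
    refine ⟨hpos m hm, ?_⟩
    have h := Finset.single_le_sum (f := fun m' : ℤ => F.eval m') (fun m' hm' => (hpos m' hm').le) hm
    exact_mod_cast h
  set xF : ℝ := ∑ m' ∈ I, ((F.eval m' : ℤ) : ℝ) with hxF
  -- the sifted sum is `S(𝒜, z)`
  have hfilter : I.filter (fun m : ℤ => ∀ k, k ≠ i → Int.gcd ((Ψ k).eval (fun _ => m)) (primesProdBelow z) = 1) =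
      I.filter (fun m : ℤ => (F.eval m).natAbs.Coprime (primesProdBelow z)) := by
    refine Finset.filter_congr fun m _ => ?_
    rw [hF, sysPoly_removeNth_eval]
    have hprod : (∏ k : Fin t, (Ψ (i.succAbove k)).eval (fun _ => m)).natAbs =
        ∏ k : Fin t, ((Ψ (i.succAbove k)).eval (fun _ => m)).natAbs :=
      map_prod Int.natAbsHom _ univ
    rw [hprod, Nat.coprime_prod_left_iff, Fin.forall_iff_succAbove i]
    simp only [ne_eq, not_true_eq_false, IsEmpty.forall_iff, true_and, Finset.mem_univ, forall_const,
      Fin.succAbove_ne, not_false_eq_true, Int.gcd_eq_natAbs, Int.natAbs_natCast,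
      Nat.coprime_iff_gcd_eq_one]
  have hsift : A.sifted xF (primesProdBelow z) = ∑ m ∈ I.filter
      (fun m : ℤ => ∀ k, k ≠ i → Int.gcd ((Ψ k).eval (fun _ => m)) (primesProdBelow z) = 1),
        intVonMangoldt (a * m + b) := by
    rw [sifted_eq_of_eq hAa hFpos, hfilter]
  have hV : A.densityProduct (primesProdBelow z) = V := by
    rw [SieveSequence.densityProduct, primeFactors_primesProdBelow, hAdens]
  -- the Fundamental Lemma
  have hFLA := hFL A hdim xF z D hz hzD hXi0
  rw [hsift, hV, hAsize] at hFLA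
  refine hFLA.trans (add_le_add le_rfl ?_)
  -- the remainder
  set 𝒟 := (primesProdBelow z).divisors.filter (fun d : ℕ => (d : ℝ) ≤ D) with h𝒟
  set Dn : ℕ := ⌊D⌋₊ with hDn'
  have hmem𝒟 : ∀ d ∈ 𝒟, 0 < d ∧ Squarefree d ∧ (d : ℝ) ≤ D := fun d hd => by
    have h1 := divisors_filter_subset z D hd
    rw [Finset.mem_filter, Finset.mem_Icc] at h1
    exact ⟨h1.1.1, h1.2, (Finset.mem_filter.mp hd).2⟩
  have hRd : ∀ d ∈ 𝒟, |A.remainder d xF| ≤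
      ∑ s ∈ (rootsMod F d).filter (fun s : ℕ => Int.gcd (a * s + b) d = 1),
        |∑ m ∈ I.filter (fun m : ℤ => m ≡ (s : ℤ) [ZMOD d]), intVonMangoldt (a * m + b) -
          (α : ℝ) * (#I : ℝ) / (Nat.totient (α * d) : ℝ)| + D * Θ := by
    intro d hd
    obtain ⟨hd0, hdsq, hdD⟩ := hmem𝒟 d hd
    have hφ : (0 : ℝ) < Nat.totient (α * d) := by exact_mod_cast Nat.totient_pos.mpr (Nat.mul_pos hα1 hd0)
    have hφ0 : ((Nat.totient (α * d) : ℕ) : ℝ) ≠ 0 := hφ.ne'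
    have hφa0 : ((Nat.totient α : ℕ) : ℝ) ≠ 0 := hφα.ne'
    have hgd : g d * Xi = (#((rootsMod F d).filter (fun s : ℕ => Int.gcd (a * s + b) d = 1)) : ℝ) *
        ((α : ℝ) * (#I : ℝ) / (Nat.totient (α * d) : ℝ)) := by
      have h := density_mul_totient hg hdsq
      rw [← hα] at h
      have hgd' : g d = (#((rootsMod F d).filter (fun s : ℕ => Int.gcd (a * s + b) d = 1)) : ℝ) *
          (Nat.totient α : ℝ) / (Nat.totient (α * d) : ℝ) := by
        rw [eq_div_iff hφ0]; exact h
      rw [hgd', hXi]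
      field_simp
    rw [remainder_eq_of_eq hAa hFpos hd0, hAdens, hAsize, hgd]
    refine (abs_sum_classSum_sub_le F ha0 d I hx1 hab1 hxle _).trans (add_le_add le_rfl ?_)
    exact mul_le_mul_of_nonneg_right hdD hΘ0
  have hcard𝒟 : (#𝒟 : ℝ) ≤ D := by
    have h1 : #𝒟 ≤ #(Icc 1 Dn) :=
      Finset.card_le_card ((divisors_filter_subset z D).trans (Finset.filter_subset _ _))
    rw [Nat.card_Icc, Nat.add_sub_cancel] at h1
    exact (Nat.cast_le.mpr h1).trans (Nat.floor_le hD0)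
  have hPCS := hC x hx₀ F hFB a b m₁ m₂ ha0 hab hm hab1 hxle Dn hDn
  have hlogx0 : 0 ≤ Real.log x := Real.log_nonneg hx1
  have hx0 : 0 ≤ x := by linarith
  calc ∑ d ∈ 𝒟, |A.remainder d xF|
      ≤ ∑ d ∈ 𝒟, (∑ s ∈ (rootsMod F d).filter (fun s : ℕ => Int.gcd (a * s + b) d = 1),
          |∑ m ∈ I.filter (fun m : ℤ => m ≡ (s : ℤ) [ZMOD d]), intVonMangoldt (a * m + b) -
            (α : ℝ) * (#I : ℝ) / (Nat.totient (α * d) : ℝ)| + D * Θ) := Finset.sum_le_sum hRd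
    _ = ∑ d ∈ 𝒟, ∑ s ∈ (rootsMod F d).filter (fun s : ℕ => Int.gcd (a * s + b) d = 1),
          |∑ m ∈ I.filter (fun m : ℤ => m ≡ (s : ℤ) [ZMOD d]), intVonMangoldt (a * m + b) -
            (α : ℝ) * (#I : ℝ) / (Nat.totient (α * d) : ℝ)| + #𝒟 * (D * Θ) := by
        rw [Finset.sum_add_distrib, Finset.sum_const, nsmul_eq_mul]
    _ ≤ ∑ d ∈ (Icc 1 Dn).filter Squarefree,
          ∑ s ∈ (rootsMod F d).filter (fun s : ℕ => Int.gcd (a * s + b) d = 1),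
            |∑ m ∈ I.filter (fun m : ℤ => m ≡ (s : ℤ) [ZMOD d]), intVonMangoldt (a * m + b) -
              (α : ℝ) * (#I : ℝ) / (Nat.totient (α * d) : ℝ)| + D * (D * Θ) := by
        refine add_le_add (Finset.sum_le_sum_of_subset_of_nonneg (divisors_filter_subset z D)
          fun d _ _ => Finset.sum_nonneg fun s _ => abs_nonneg _) ?_
        exact mul_le_mul_of_nonneg_right hcard𝒟 (by positivity)
    _ ≤ C * x / Real.log x ^ (t + 1) + D * (D * Θ) := add_le_add hPCS le_rfl
    _ ≤ max C 1 * x / Real.log x ^ (t + 1) + D ^ 2 * Θ := by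
        have h1 : C * x / Real.log x ^ (t + 1) ≤ max C 1 * x / Real.log x ^ (t + 1) := by
          refine div_le_div_of_nonneg_right ?_ (by positivity)
          exact mul_le_mul_of_nonneg_right (le_max_left _ _) hx0
        have h2 : D * (D * Θ) = D ^ 2 * Θ := by ring
        linarith

end Cases

end Summit.Parity.GeneralizedHardyLittlewood.Cruxes.DimOne.BirthSieve

end
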